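import Summits.Ventures.CertifiedManyBodySolver.Observables.BraggWeightWiener
import Mathlib.MeasureTheory.Integral.Prod
import Mathlib.MeasureTheory.Measure.Haar.NormedSpace
import Mathlib.MeasureTheory.Measure.Haar.InnerProductSpace
import HarnessLib

/-!
# No Bragg-weight FLOOR from finitely many two-point windows: long-range order is invisible to every
# finite-footprint certificate of non-zero width

HONEST FRAMING: first certified bounds on pairing observables; not a superconductivity verdict; every number
certified (two lineages + referee) or labelled float.  Pure measure theory; zero compute; NO definition, no named
fact, no `sorry`.  Cell hubbard-obs (D-0042 crew 1), seat hubbard-obs-p3 (CONTROLS), gen 2 — the formal version of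
the standing rule «a ceiling on a Bragg weight says nothing about the presence of order» (HOME/TARGET.md §3 "What
C2 is NOT"; sr-mbsolver RESOLUTION §0 (11)).

Setting (as in `Observables/StripeOrderKernels.lean`, `BraggWeightWiener.lean`): a finite measure `μ` on `ℝᵈ`
REPRESENTS a lattice function `C : ℤᵈ → ℂ` when `∫ e^{i r·ξ} dμ(ξ) = C r` for all `r` (Herglotz; `C` = a two-point
function of a translation-invariant state); the Bragg weight `braggWeight μ Q = μ(⋃ⱼ Qⱼ + 2πℤᵈ)` is the squared
long-range-order parameter at the star `Q` (Wiener, `tendsto_boxPairMean_re_braggWeight`).  The cell's rows certify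
finitely many numbers `Re C(r)`, `r ∈ S` (a finite footprint), each to a window of non-zero width.  CEILINGS on
Bragg weights follow from such data (`kernelCeiling_braggWeight_le`, `BoxRowBraggCeilings.lean`).  FLOORS never do:

* `exists_noBraggWeight_close_moments` (`d ≥ 1`): for every finite `μ` representing `C` and every `δ > 0` there is
  a finite measure `ν` with THE SAME TOTAL MASS, ALL Bragg weights ZERO (every star, every wavevector), and moments
  `‖∫ e^{i r·ξ} dν − C r‖ ≤ μ(ℝᵈ) · δ · Σᵢ |rᵢ|` for EVERY `r ∈ ℤᵈ`.  Construction: `ν = μ ∗ ρ_δ`, `ρ_δ` = normalised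
  Lebesgue measure of the closed ball of radius `δ` (the push-forward of `μ ⊗ ρ_δ` under addition): an atom-free
  smoothing — countable sets are `ρ_δ`-null, hence `ν`-null by Tonelli — whose characteristic function is `δ·|r|₁`-close
  to `1` on the ball (`‖e^{iθ} − 1‖ ≤ |θ|`).
* `exists_noBraggWeight_close_moments_on` : hence for every FINITE `S ⊂ ℤᵈ` and `ε > 0` some such `ν` has
  `‖ν̂(r) − C r‖ ≤ ε` on `S`.
* `exists_noBraggWeight_in_strict_windows` — THE BARRIER SENTENCE: if the data are STRICT windows
  `lo r < Re C r < hi r` (`r ∈ S`, `S` finite) satisfied by some represented `C`, then they are also satisfied by a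
  represented lattice function (`r ↦ ν̂(r)`, same total mass `= C 0`) ALL of whose Bragg weights vanish.  So no
  finite family of finite-footprint two-point windows of non-zero width — in particular no finite set of the cell's
  certified correlator rows, at any level, with any energy window — implies a positive lower bound on any Bragg weight:
  stripe / Néel / pair ODLRO PRESENCE is not a sentence this instrument can write; only ceilings are
  (complementing p1's `PairBoxCeilingSharpness.lean`, which bounds how good the ceilings can be).  Evasions: inputs
  uniform in `r` (certified decay or clustering at ALL ranges, `PairTailCeiling.lean`), or exact (zero-width)
  infinitely many moments.

References: Katznelson, *An Introduction to Harmonic Analysis* (2004) I.7 (a measure is determined only by ALL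
its Fourier–Stieltjes coefficients); Billingsley, *Convergence of Probability Measures* (1999) §1 (smoothing by
convolution). [folklore]
-/

noncomputable section

open MeasureTheory Complex Filter Topology Set
open scoped Real BigOperators ENNReal

namespace Summit.Ventures.CertifiedManyBodySolver.Observables

variable {d : ℕ}

/-! ### Countability of Bragg sets; the unit-circle estimate -/

/-- `Q + 2πℤᵈ` is countable. [folklore] -/
theorem countable_braggSet (Q : Fin d → ℝ) : (braggSet Q).Countable := by
  have h : braggSet Q ⊆ Set.range (fun m : Fin d → ℤ =>
      (WithLp.toLp 2 (fun i => Q i + 2 * π * m i) : EuclideanSpace ℝ (Fin d))) := by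
    rintro ξ ⟨m, hm⟩
    refine ⟨m, ?_⟩
    ext i
    simp [hm i]
  exact (Set.countable_range _).mono h

/-- A finite union of Bragg sets is countable. [folklore] -/
theorem countable_iUnion_braggSet {n : ℕ} (Q : Fin n → (Fin d → ℝ)) : (⋃ j, braggSet (Q j)).Countable :=
  Set.countable_iUnion fun j => countable_braggSet (Q j)

/-- `‖e^{iθ} − 1‖ ≤ |θ|` (`= 2|sin(θ/2)|`). [folklore] -/
theorem norm_exp_ofReal_mul_I_sub_one_le (θ : ℝ) : ‖exp ((θ : ℂ) * I) - 1‖ ≤ |θ| := by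
  rw [mul_comm, Complex.norm_exp_I_mul_ofReal_sub_one, Real.norm_eq_abs, abs_mul, abs_two]
  have h := Real.abs_sin_le_abs (x := θ / 2)
  rw [abs_div, abs_two] at h
  linarith

/-- The lattice character `ξ ↦ e^{i r·ξ}` is multiplicative: `e^{i r·(x+y)} = e^{i r·x} e^{i r·y}`. [folklore] -/
theorem exp_latticeChar_add (r : Fin d → ℤ) (x y : EuclideanSpace ℝ (Fin d)) :
    exp ((∑ i, (r i : ℝ) * (x + y) i : ℝ) * I) =
      exp ((∑ i, (r i : ℝ) * x i : ℝ) * I) * exp ((∑ i, (r i : ℝ) * y i : ℝ) * I) := by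
  rw [← Complex.exp_add]
  congr 1
  have : (∑ i, (r i : ℝ) * (x + y) i : ℝ) = (∑ i, (r i : ℝ) * x i) + ∑ i, (r i : ℝ) * y i := by
    rw [← Finset.sum_add_distrib]
    exact Finset.sum_congr rfl fun i _ => by rw [WithLp.ofLp_add, Pi.add_apply]; ring
  rw [this]; push_cast; ring

/-- On the closed ball of radius `δ`: `‖e^{i r·ζ} − 1‖ ≤ δ · Σᵢ |rᵢ|`. [folklore] -/
theorem norm_exp_latticeChar_sub_one_le (r : Fin d → ℤ) {δ : ℝ} {ζ : EuclideanSpace ℝ (Fin d)}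
    (hζ : ζ ∈ Metric.closedBall (0 : EuclideanSpace ℝ (Fin d)) δ) :
    ‖exp ((∑ i, (r i : ℝ) * ζ i : ℝ) * I) - 1‖ ≤ δ * ∑ i, |(r i : ℝ)| := by
  rw [mem_closedBall_zero_iff] at hζ
  refine (norm_exp_ofReal_mul_I_sub_one_le _).trans ?_
  refine (Finset.abs_sum_le_sum_abs _ _).trans ?_
  rw [Finset.mul_sum]
  refine Finset.sum_le_sum fun i _ => ?_
  rw [abs_mul]
  have hi : |ζ i| ≤ δ := le_trans (by simpa [Real.norm_eq_abs] using PiLp.norm_apply_le ζ i) hζ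
  nlinarith [abs_nonneg (r i : ℝ), abs_nonneg (ζ i)]

/-! ### The smoothing theorem -/

/-- **Atom-free smoothing with controlled moments.**  Let `d ≥ 1`, `μ` a finite measure on `ℝᵈ` representing
`C : ℤᵈ → ℂ`, and `δ > 0`.  Then there is a finite measure `ν` on `ℝᵈ` with `ν(ℝᵈ) = μ(ℝᵈ)`, with
`braggWeight ν Q = 0` for EVERY finite family of wavevectors `Q` (no Bragg peak anywhere), and with
`‖∫ e^{i r·ξ} dν − C r‖ ≤ μ(ℝᵈ) · δ · Σᵢ |rᵢ|` for every `r ∈ ℤᵈ`.  (`ν` = push-forward of `μ ⊗ ρ_δ` under addition,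
`ρ_δ` = normalised Lebesgue measure on the closed `δ`-ball: countable sets are `ρ_δ`-null, hence `ν`-null by
Tonelli; `ν̂(r) = C(r)·ρ̂_δ(r)` by Fubini and `‖ρ̂_δ(r) − 1‖ ≤ δ|r|₁`.) [folklore] -/
theorem exists_noBraggWeight_close_moments (hd : 0 < d) {C : (Fin d → ℤ) → ℂ}
    (μ : Measure (EuclideanSpace ℝ (Fin d))) [IsFiniteMeasure μ]
    (hμ : ∀ r : Fin d → ℤ, ∫ ξ, exp ((∑ i, (r i : ℝ) * ξ i : ℝ) * I) ∂μ = C r) {δ : ℝ} (hδ : 0 < δ) :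
    ∃ ν : Measure (EuclideanSpace ℝ (Fin d)), IsFiniteMeasure ν ∧ ν univ = μ univ ∧
      (∀ {n : ℕ} (Q : Fin n → (Fin d → ℝ)), braggWeight ν Q = 0) ∧
      ∀ r : Fin d → ℤ, ‖(∫ ξ, exp ((∑ i, (r i : ℝ) * ξ i : ℝ) * I) ∂ν) - C r‖ ≤
        μ.real univ * (δ * ∑ i, |(r i : ℝ)|) := by
  classical
  haveI : Nontrivial (EuclideanSpace ℝ (Fin d)) :=
    ⟨⟨EuclideanSpace.single ⟨0, hd⟩ (1 : ℝ), 0, fun h => by simpa using congrArg (fun v => v ⟨0, hd⟩) h⟩⟩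
  set B : Set (EuclideanSpace ℝ (Fin d)) := Metric.closedBall 0 δ with hB
  have hBmeas : MeasurableSet B := Metric.isClosed_closedBall.measurableSet
  have hBpos : volume B ≠ 0 := (Metric.measure_closedBall_pos volume _ hδ).ne'
  have hBfin : volume B ≠ ∞ := measure_closedBall_lt_top.ne
  set ρ : Measure (EuclideanSpace ℝ (Fin d)) := (volume B)⁻¹ • volume.restrict B with hρ
  have hρuniv : ρ univ = 1 := by
    rw [hρ, Measure.smul_apply, Measure.restrict_apply_univ, smul_eq_mul, ENNReal.inv_mul_cancel hBpos hBfin]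
  haveI : IsProbabilityMeasure ρ := ⟨hρuniv⟩
  have hρnull : ∀ s : Set (EuclideanSpace ℝ (Fin d)), s.Countable → ρ s = 0 := by
    intro s hs
    rw [hρ, Measure.smul_apply, Measure.restrict_apply' hBmeas, smul_eq_mul,
      Set.Countable.measure_zero (hs.mono Set.inter_subset_left) volume, mul_zero]
  have hρB : ∀ᵐ ζ ∂ρ, ζ ∈ B := by
    rw [hρ]; exact Measure.ae_smul_measure (ae_restrict_mem hBmeas) _
  have hadd : Measurable (fun p : EuclideanSpace ℝ (Fin d) × EuclideanSpace ℝ (Fin d) => p.1 + p.2) :=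
    measurable_fst.add measurable_snd
  refine ⟨(μ.prod ρ).map (fun p => p.1 + p.2), inferInstance, ?_, ?_, ?_⟩
  · rw [Measure.map_apply hadd MeasurableSet.univ, Set.preimage_univ, ← Set.univ_prod_univ, Measure.prod_prod,
      hρuniv, mul_one]
  · intro n Q
    have hA : (⋃ j, braggSet (Q j)).Countable := countable_iUnion_braggSet Q
    have hAm : MeasurableSet (⋃ j, braggSet (Q j)) := MeasurableSet.iUnion fun j => measurableSet_braggSet _
    have hx : ∀ x : EuclideanSpace ℝ (Fin d),
        ρ (Prod.mk x ⁻¹' ((fun p : EuclideanSpace ℝ (Fin d) × EuclideanSpace ℝ (Fin d) => p.1 + p.2) ⁻¹'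
          ⋃ j, braggSet (Q j))) = 0 :=
      fun x => hρnull _ (hA.preimage (add_right_injective x))
    unfold braggWeight
    rw [Measure.map_apply hadd hAm, Measure.prod_apply (hadd hAm)]
    simp_rw [hx, lintegral_zero, ENNReal.toReal_zero]
  · intro r
    set f : EuclideanSpace ℝ (Fin d) → ℂ := fun ξ => exp ((∑ i, (r i : ℝ) * ξ i : ℝ) * I) with hf
    have hfc : Continuous f :=
      Complex.continuous_exp.comp ((Complex.continuous_ofReal.comp (by fun_prop)).mul continuous_const)
    have hf1 : ∀ ξ, ‖f ξ‖ ≤ 1 := fun ξ => by rw [hf]; exact le_of_eq (Complex.norm_exp_ofReal_mul_I _)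
    have hfi : ∀ (κ : Measure (EuclideanSpace ℝ (Fin d))) [IsFiniteMeasure κ], Integrable f κ := fun κ _ =>
      Integrable.mono' (integrable_const (1 : ℝ)) hfc.aestronglyMeasurable (ae_of_all _ hf1)
    have hint : ∫ ξ, f ξ ∂((μ.prod ρ).map (fun p => p.1 + p.2)) = (∫ x, f x ∂μ) * ∫ y, f y ∂ρ := by
      rw [integral_map hadd.aemeasurable hfc.aestronglyMeasurable]
      have : (fun p : EuclideanSpace ℝ (Fin d) × EuclideanSpace ℝ (Fin d) => f (p.1 + p.2))
          = fun p => f p.1 * f p.2 := funext fun p => exp_latticeChar_add r p.1 p.2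
      rw [this]
      exact integral_prod_mul f f
    have hC : ‖C r‖ ≤ μ.real univ := by
      rw [← hμ r]
      calc ‖∫ x, f x ∂μ‖ ≤ 1 * μ.real univ := norm_integral_le_of_norm_le_const (ae_of_all _ hf1)
        _ = μ.real univ := one_mul _
    have hψ : ‖(∫ y, f y ∂ρ) - 1‖ ≤ δ * ∑ i, |(r i : ℝ)| := by
      have h1 : (∫ y, f y ∂ρ) - 1 = ∫ y, (f y - 1) ∂ρ := by
        rw [integral_sub (hfi ρ) (integrable_const _), integral_const, probReal_univ, one_smul]
      rw [h1]
      calc ‖∫ y, (f y - 1) ∂ρ‖ ≤ (δ * ∑ i, |(r i : ℝ)|) * ρ.real univ :=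
            norm_integral_le_of_norm_le_const (hρB.mono fun ζ hζ => norm_exp_latticeChar_sub_one_le r hζ)
        _ = δ * ∑ i, |(r i : ℝ)| := by rw [probReal_univ, mul_one]
    rw [hint, hμ r, show C r * (∫ y, f y ∂ρ) - C r = C r * ((∫ y, f y ∂ρ) - 1) by ring, norm_mul]
    exact mul_le_mul hC hψ (norm_nonneg _) measureReal_nonneg

/-- **Finite footprints**: for every finite `S ⊂ ℤᵈ` and `ε > 0` there is a finite measure with the same total mass,
NO Bragg weight anywhere, and moments `ε`-close to `C` on `S`. [folklore] -/
theorem exists_noBraggWeight_close_moments_on (hd : 0 < d) {C : (Fin d → ℤ) → ℂ}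
    (μ : Measure (EuclideanSpace ℝ (Fin d))) [IsFiniteMeasure μ]
    (hμ : ∀ r : Fin d → ℤ, ∫ ξ, exp ((∑ i, (r i : ℝ) * ξ i : ℝ) * I) ∂μ = C r)
    (S : Finset (Fin d → ℤ)) {ε : ℝ} (hε : 0 < ε) :
    ∃ ν : Measure (EuclideanSpace ℝ (Fin d)), IsFiniteMeasure ν ∧ ν univ = μ univ ∧
      (∀ {n : ℕ} (Q : Fin n → (Fin d → ℝ)), braggWeight ν Q = 0) ∧
      ∀ r ∈ S, ‖(∫ ξ, exp ((∑ i, (r i : ℝ) * ξ i : ℝ) * I) ∂ν) - C r‖ ≤ ε := by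
  set M : ℝ := ∑ r ∈ S, ∑ i, |(r i : ℝ)| with hM
  have hM0 : 0 ≤ M := Finset.sum_nonneg fun r _ => Finset.sum_nonneg fun i _ => abs_nonneg _
  have hrM : ∀ r ∈ S, ∑ i, |(r i : ℝ)| ≤ M := fun r hr =>
    Finset.single_le_sum (f := fun r : Fin d → ℤ => ∑ i, |(r i : ℝ)|)
      (fun r _ => Finset.sum_nonneg fun i _ => abs_nonneg _) hr
  set K : ℝ := μ.real univ * M + 1 with hK
  have hK0 : 0 < K := by have := measureReal_nonneg (μ := μ) (s := univ); positivity
  obtain ⟨ν, hfin, huniv, hB, hmom⟩ := exists_noBraggWeight_close_moments hd μ hμ (δ := ε / K) (by positivity)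
  refine ⟨ν, hfin, huniv, hB, fun r hr => (hmom r).trans ?_⟩
  have hμ0 : 0 ≤ μ.real univ := measureReal_nonneg
  calc μ.real univ * (ε / K * ∑ i, |(r i : ℝ)|) ≤ μ.real univ * (ε / K * M) := by
        gcongr; exact hrM r hr
    _ = ε * (μ.real univ * M / K) := by ring
    _ ≤ ε * 1 := by
        gcongr
        rw [div_le_one hK0, hK]; linarith
    _ = ε := mul_one ε

/-- **THE BARRIER: no finite family of strict two-point windows forces a Bragg weight.**  Let `μ` (finite, `d ≥ 1`)
represent `C`, and suppose `C` satisfies finitely many STRICT windows `lo r < Re C r < hi r`, `r ∈ S`.  Then there is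
a finite measure `ν` with the same total mass whose moments `ν̂(r) = ∫ e^{i r·ξ} dν` satisfy the SAME windows on `S`
and whose Bragg weight vanishes at EVERY finite family of wavevectors.  Hence the largest lower bound on any Bragg
weight (squared stripe / Néel / pair order parameter) implied by such data is `0`: certified finite-footprint rows of
non-zero width can only ever give CEILINGS. [folklore] -/
theorem exists_noBraggWeight_in_strict_windows (hd : 0 < d) {C : (Fin d → ℤ) → ℂ}
    (μ : Measure (EuclideanSpace ℝ (Fin d))) [IsFiniteMeasure μ]
    (hμ : ∀ r : Fin d → ℤ, ∫ ξ, exp ((∑ i, (r i : ℝ) * ξ i : ℝ) * I) ∂μ = C r)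
    (S : Finset (Fin d → ℤ)) (lo hi : (Fin d → ℤ) → ℝ)
    (hwin : ∀ r ∈ S, lo r < (C r).re ∧ (C r).re < hi r) :
    ∃ ν : Measure (EuclideanSpace ℝ (Fin d)), IsFiniteMeasure ν ∧ ν univ = μ univ ∧
      (∀ {n : ℕ} (Q : Fin n → (Fin d → ℝ)), braggWeight ν Q = 0) ∧
      ∀ r ∈ S, lo r < (∫ ξ, exp ((∑ i, (r i : ℝ) * ξ i : ℝ) * I) ∂ν).re ∧
        (∫ ξ, exp ((∑ i, (r i : ℝ) * ξ i : ℝ) * I) ∂ν).re < hi r := by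
  -- a common margin `ε > 0` below every window slack
  set g : (Fin d → ℤ) → ℝ := fun r => min ((C r).re - lo r) (hi r - (C r).re) with hg
  have hgpos : ∀ r ∈ S, 0 < g r := fun r hr => lt_min (by linarith [(hwin r hr).1]) (by linarith [(hwin r hr).2])
  obtain ⟨ε, hε, hεg⟩ : ∃ ε : ℝ, 0 < ε ∧ ∀ r ∈ S, ε < g r := by
    by_cases hS : S.Nonempty
    · obtain ⟨r₀, hr₀, hmin⟩ := S.exists_min_image g hS
      exact ⟨g r₀ / 2, by linarith [hgpos r₀ hr₀], fun r hr => by linarith [hmin r hr, hgpos r₀ hr₀]⟩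
    · exact ⟨1, one_pos, fun r hr => (hS ⟨r, hr⟩).elim⟩
  obtain ⟨ν, hfin, huniv, hB, hmom⟩ := exists_noBraggWeight_close_moments_on hd μ hμ S hε
  refine ⟨ν, hfin, huniv, hB, fun r hr => ?_⟩
  have h := (abs_re_le_norm _).trans (hmom r hr)
  rw [Complex.sub_re, abs_le] at h
  have h1 := hεg r hr
  have h2 : g r ≤ (C r).re - lo r := min_le_left _ _
  have h3 : g r ≤ hi r - (C r).re := min_le_right _ _
  constructor <;> linarith [h.1, h.2]

end Summit.Ventures.CertifiedManyBodySolver.Observables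

end
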